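import Summits.QuantumFields.BalabanUV.Beta.FP.KernelPeriodisationFibHessKer

/-!
# `BalabanUV.Beta.FP.KernelPeriodisationFibImageSum` — road «FP» (binder row D1), ROUTE T, (T-PER) PART 4⁶ = **(P2⁶): THE IMAGE SUM IN THE RELATIVE BOND
# SLOT OF A FINITE-RANGE BI-TABLE COLLAPSES ON LARGE BOXES** — for a second-order table family `z′ ↦ T z′` that VANISHES beyond a range `R` in the
# relative coarse bond variable, the torus bi-member's image sum `Σ'_n T (z + M′∘n)` (leaf-02 g22's U20∕U21 `hW`: an2's periodised Wilson bi-member,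
# second slot summed over the period copies) IS `T z` as soon as every period exceeds `R + |z|₁`; hence along growing boxes the torus jet
# `perF (dper (Σ'_n T (z + M′_k∘n)))` is EVENTUALLY `perF (dper (T z))` and (P2‴)'s `tendsto_hessT_perF ∕ _hessKer` apply by `Tendsto.congr'`

WHY (NOTE N-1 [D1LEAF06-G23-N1] (ii), HOME/CLAIMS.log l.46882).  (P2‴) §3 takes the second jet as `perF (Mk k) (dper (Mk k) (𝒲 μ 0 ν z))` with `𝒲` a FIXED
lattice family; the door's ORDER-2 bi-tables carry, at a fixed lattice pair, the k-DEPENDENT image sum in the relative slot.  For FINITE-RANGE bi-tables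
(the Wilson class: plaquette range) the sum has exactly one non-zero term once the box is large, so no estimate is needed — only this bookkeeping.  The
relative-DECAY route (resolvent-dressed bi-tables) is a (P2)-class estimate and NOT here (N-1 (ii), on the OWNER's word).
CONTENT ([folklore]; no `def`, no `def … : Prop`, nothing cited, 0 sorry; 0 estimates):
§1 `translate_ne_self_far` (`n ≠ 0 ∧ ∀ i, N ≤ M i ⇒ N ≤ |translate M z n − z|₁`), **`tsum_translate_eq_self_of_finiteRange`** (`(∀ z′, R < |z′ − z₀|₁ → T z′ = 0) ∧
(∀ i, N ≤ M i) ∧ R + |z − z₀|₁ < N ⇒ Σ'_n T (translate M z n) = T z` — as an equality in ANY additive commutative topological group, e.g. of lattice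
kernels `MKer`), `eventually_tsum_translate_eq_self` (along boxes with `∀ N, ∀ᶠ k, ∀ i, N ≤ Mk k i`); §2 **`tendsto_hessT_perF_imageSum`** ((P2‴)
`tendsto_hessT_perF` with the `W`-slot replaced by the image-summed k-dependent jet, under finite range) and **`tendsto_hessT_perF_hessKer_imageSum`**
(the `hessKer` form for base-point families whose second-order member has finite range in the relative coarse variable).
Moves NO (CONV-C) clause and NO row-D1 binder; NOT (T-ID), NOT SDF, NOT D1, NOT BetaPertH, NOT continuum, NOT Clay.

HONEST DEPENDENCY (page 1, mandatory): continuum YM on T⁴ ⇐ BetaPertH ∧ nine spine estimates (0/9 proved); BetaPertH ⇐ (D1) ∧ (D4) ∧ CAP+tail;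
G-an2-4 gates asym, D1 and NE2/3/4.  HONEST FRAMING (cell contract, verbatim): «discharging `BetaPertH` makes Bałaban's UV stability UNCONDITIONAL —
a real constructive-QFT result; it is NOT the continuum limit and NOT the Clay problem.»  ABSOLUTE RULE (cell charter, verbatim): «No internally-minted
statement may enter as a cited fact. Every hypothesis is either kernel-proved in this package or a verbatim quotation of a PUBLISHED theorem with page
reference. The manuscript(s) under audit are NOT citable for their own disputed steps — they are the thing under adjudication; programme-internal
(2001/route/tribunal) claims are never citable.»  Nothing of Bałaban's asserted.  D1 formalisation swarm LEAF PROVER 06 (b2b-balaban-beta-d1-formalise-leaf-06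
gen 23), 2026-08-22.  No existing file touched.
-/

noncomputable section

open scoped BigOperators Matrix Topology
open Finset Filter

namespace Summit.QuantumFields.BalabanUV.Beta.FP.KernelPeriodisationFibImageSum

open Literature.MathematicalPhysics.QuantumFieldTheory.Balaban1983to89
open Literature.MathematicalPhysics.QuantumFieldTheory.Balaban1983to89.Beta
open B12Sec2to5 (l1 l1_nonneg)
open B4TorusKernel.MultiPeriod (translate)
open ExpKernelCalculus (MKer Decays BiLoc bubble tadpole hessKer)
open Summit.QuantumFields.BalabanUV.Beta.D1BFx.MixedVarPackedHess (hessT)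
open Summit.QuantumFields.BalabanUV.Beta.FP.KernelPeriodisationFib (perF)
open Summit.QuantumFields.BalabanUV.Beta.FP.KernelPeriodisationFibLoc (dper)
open Summit.QuantumFields.BalabanUV.Beta.FP.KernelPeriodisationFibTrace (le_l1_Mmul translate_sub_self)
open Summit.QuantumFields.BalabanUV.Beta.FP.KernelPeriodisationFibHessKer (tendsto_hessT_perF tendsto_hessT_perF_hessKer)

variable {d : ℕ}

/-! ## §1 The image sum of a finite-range family collapses on large boxes -/

section Collapse

variable {G : Type*} [AddCommGroup G] [TopologicalSpace G]

/-- [folklore] A non-zero period translate is at least one period away: `n ≠ 0`, `∀ i, N ≤ M i` ⇒ `N ≤ |translate M z n − z|₁`. -/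
theorem le_l1_translate_sub (M : Fin (d + 1) → ℕ) {N : ℕ} (hMN : ∀ i, N ≤ M i) (z : Fin (d + 1) → ℤ) {n : Fin (d + 1) → ℤ} (hn : n ≠ 0) :
    (N : ℝ) ≤ l1 (translate M z n - z) := by
  rw [translate_sub_self]
  exact le_l1_Mmul M hMN hn

/-- [folklore] **`tsum_translate_eq_self_of_finiteRange` — THE IMAGE SUM OF A FINITE-RANGE FAMILY COLLAPSES**: if `T z′ = 0` whenever `R < |z′ − z₀|₁`,
all periods are `≥ N` and `R + |z − z₀|₁ < N`, then `Σ'_n T (translate M z n) = T z` (only the `n = 0` image is inside the range). -/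
theorem tsum_translate_eq_self_of_finiteRange (M : Fin (d + 1) → ℕ) {T : (Fin (d + 1) → ℤ) → G} {R : ℝ} {z₀ : Fin (d + 1) → ℤ}
    (hT : ∀ z', R < l1 (z' - z₀) → T z' = 0) {N : ℕ} (hMN : ∀ i, N ≤ M i) {z : Fin (d + 1) → ℤ} (hz : R + l1 (z - z₀) < N) :
    ∑' n : Fin (d + 1) → ℤ, T (translate M z n) = T z := by
  have hvan : ∀ n : Fin (d + 1) → ℤ, n ≠ 0 → T (translate M z n) = 0 := by
    intro n hn
    apply hT
    -- `|translate M z n − z₀|₁ ≥ |translate M z n − z|₁ − |z − z₀|₁ ≥ N − |z − z₀|₁ > R`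
    have h1 : (N : ℝ) ≤ l1 (translate M z n - z) := le_l1_translate_sub M hMN z hn
    have h2 : l1 (translate M z n - z) ≤ l1 (translate M z n - z₀) + l1 (z - z₀) := by
      have := ExpKernelCalculus.l1_sub_triangle (translate M z n) z₀ z
      -- `l1 (a - c) ≤ l1 (a - b) + l1 (b - c)` with `(a, b, c) := (translate M z n, z₀, z)`: `|x−z| ≤ |x−z₀| + |z₀−z|`
      rw [ExpKernelCalculus.l1_sub_symm z₀ z] at this
      exact this
    linarith
  have h0 : translate M z 0 = z := by
    funext i; simp [B4TorusKernel.MultiPeriod.translate_apply]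
  rw [tsum_eq_single 0 hvan, h0]

/-- [folklore] **ALONG GROWING BOXES THE IMAGE SUM IS EVENTUALLY THE SINGLE TERM**: with `∀ N, ∀ᶠ k, ∀ i, N ≤ Mk k i` (#23's sentence),
`∀ᶠ k, Σ'_n T (translate (Mk k) z n) = T z`. -/
theorem eventually_tsum_translate_eq_self (Mk : ℕ → (Fin (d + 1) → ℕ)) (hMk : ∀ N : ℕ, ∀ᶠ k in atTop, ∀ i, N ≤ Mk k i)
    {T : (Fin (d + 1) → ℤ) → G} {R : ℝ} {z₀ : Fin (d + 1) → ℤ} (hT : ∀ z', R < l1 (z' - z₀) → T z' = 0) (z : Fin (d + 1) → ℤ) :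
    ∀ᶠ k in atTop, ∑' n : Fin (d + 1) → ℤ, T (translate (Mk k) z n) = T z := by
  obtain ⟨N, hN⟩ := exists_nat_gt (R + l1 (z - z₀))
  filter_upwards [hMk N] with k hk
  exact tsum_translate_eq_self_of_finiteRange (Mk k) hT hk hN

end Collapse

/-! ## §2 (P2‴) with an image-summed second jet of finite range -/

section HessT

variable {F : Type*} [Fintype F]
variable {A U V : MKer (d + 1) F} {CA CU CV CW α δU δV δW : ℝ} {p q p' q' p'' q'' : Fin (d + 1) → ℤ}

/-- [folklore] **`tendsto_hessT_perF_imageSum`** — (P2‴) `tendsto_hessT_perF` with the second-jet slot the IMAGE-SUMMED, k-dependent torus bi-member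
`perF (dper (Σ'_n 𝒲 (translate (Mk k) z n)))` of a FINITE-RANGE family `𝒲` (`𝒲 z′ = 0` for `R < |z′ − z₀|₁`; `𝒲 z` bi-localised):
`hessT (perF A) (perF (dper U)) (perF (dper V)) (perF (dper (Σ'_n 𝒲 (z + Mk k∘n)))) → ½·(tadpole A (𝒲 z) − bubble A U V)`. -/
theorem tendsto_hessT_perF_imageSum (Mk : ℕ → (Fin (d + 1) → ℕ)) [∀ k μ, NeZero (Mk k μ)]
    (hMk : ∀ N : ℕ, ∀ᶠ k in atTop, ∀ i, N ≤ Mk k i) (hA : Decays A CA α) (hα : 0 < α)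
    (hAinv : ∀ k (m x y : Fin (d + 1) → ℤ) (a b : F), A (translate (Mk k) x m) (translate (Mk k) y m) a b = A x y a b)
    (hU : BiLoc U p q CU δU) (hδU : 0 < δU) (hV : BiLoc V p' q' CV δV) (hδV : 0 < δV)
    (𝒲 : (Fin (d + 1) → ℤ) → MKer (d + 1) F) {R : ℝ} {z₀ : Fin (d + 1) → ℤ} (h𝒲 : ∀ z', R < l1 (z' - z₀) → 𝒲 z' = 0)
    (z : Fin (d + 1) → ℤ) (hW : BiLoc (𝒲 z) p'' q'' CW δW) (hδW : 0 < δW) :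
    Tendsto (fun k => hessT (perF (Mk k) A) (perF (Mk k) (dper (Mk k) U)) (perF (Mk k) (dper (Mk k) V))
        (perF (Mk k) (dper (Mk k) (∑' n : Fin (d + 1) → ℤ, 𝒲 (translate (Mk k) z n))))) atTop
      (𝓝 ((1 / 2 : ℝ) * (tadpole A (𝒲 z) - bubble A U V))) := by
  refine (tendsto_hessT_perF Mk hMk hA hα hAinv hU hδU hV hδV hW hδW).congr' ?_
  filter_upwards [eventually_tsum_translate_eq_self Mk hMk h𝒲 z] with k hk
  rw [hk]

/-- [folklore] **`tendsto_hessT_perF_hessKer_imageSum`** — the `hessKer` form: base-point families `𝒱 𝒲` as in (P2‴) §3, the second-order member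
`z′ ↦ 𝒲 μ 0 ν z′` of FINITE RANGE in the relative coarse variable, the torus second jet its image sum ⟹ `→ hessKer A 𝒱 𝒲 μ ν z`. -/
theorem tendsto_hessT_perF_hessKer_imageSum (Mk : ℕ → (Fin (d + 1) → ℕ)) [∀ k μ, NeZero (Mk k μ)]
    (hMk : ∀ N : ℕ, ∀ᶠ k in atTop, ∀ i, N ≤ Mk k i) (hA : Decays A CA α) (hα : 0 < α)
    (hAinv : ∀ k (m x y : Fin (d + 1) → ℤ) (a b : F), A (translate (Mk k) x m) (translate (Mk k) y m) a b = A x y a b)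
    (𝒱 : Fin (d + 1) → (Fin (d + 1) → ℤ) → MKer (d + 1) F) (𝒲 : Fin (d + 1) → (Fin (d + 1) → ℤ) → Fin (d + 1) → (Fin (d + 1) → ℤ) → MKer (d + 1) F)
    (μ ν : Fin (d + 1)) (z : Fin (d + 1) → ℤ) {Cv Cv' Cw δ : ℝ} {pv pv' qv qv' : Fin (d + 1) → ℤ}
    (hV : BiLoc (𝒱 μ 0) pv pv' Cv δ) (hV' : BiLoc (𝒱 ν z) qv' qv Cv' δ) (hW : BiLoc (𝒲 μ 0 ν z) pv qv Cw δ) (hδ : 0 < δ)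
    {R : ℝ} {z₀ : Fin (d + 1) → ℤ} (h𝒲 : ∀ z', R < l1 (z' - z₀) → 𝒲 μ 0 ν z' = 0) :
    Tendsto (fun k => hessT (perF (Mk k) A) (perF (Mk k) (dper (Mk k) (𝒱 μ 0))) (perF (Mk k) (dper (Mk k) (𝒱 ν z)))
        (perF (Mk k) (dper (Mk k) (∑' n : Fin (d + 1) → ℤ, 𝒲 μ 0 ν (translate (Mk k) z n))))) atTop (𝓝 (hessKer A 𝒱 𝒲 μ ν z)) := by
  refine (tendsto_hessT_perF_hessKer Mk hMk hA hα hAinv 𝒱 𝒲 μ ν z hV hV' hW hδ).congr' ?_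
  filter_upwards [eventually_tsum_translate_eq_self Mk hMk (T := fun z' => 𝒲 μ 0 ν z') h𝒲 z] with k hk
  rw [hk]

end HessT

end Summit.QuantumFields.BalabanUV.Beta.FP.KernelPeriodisationFibImageSum

end
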